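import Summits.KontsevichZagierPeriods.KontsevichZagierPeriods.Theorems.ComplexOrientationsCauchyMoveDisc

/-!
# Route `ComplexOrientations`, support item `CauchyMove` (stmt-KontsevichZagierPeriods-11370):
# the Cauchy move, part D2 — Green's theorem for `Re (g dt)` on the disc as a chain of moves

Helper file (prover-owned, `--supports CauchyMove`), continuing part D1. **Theorem `green`.**
For `g` holomorphic near the closed disc `D` of radius `ρ` (real algebraic) with `Re g`, `Im g`,
`Im g'` `ℚ`-semialgebraic on `D` (as functions of `(x₀, x₁) ↦ x₀ + i x₁`), the two boundary
representations `[τ, u ↦ Re g(u, b u) − Re g(u, −b u)]` and `[τ, v ↦ Im g(b v, v) − Im g(−b v, v)]`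
(`b = √(ρ² − ·²)`) sum to an element of `KZ.relations`: each is the base of a Newton–Leibniz move
(`KZ.exists_band_newtonLeibniz`, primitives `Re g` along `x₁`, resp. `Im g` along the last
coordinate of the swapped disc), the swapped band is a change of variables of the unswapped one
by the coordinate swap (`|det| = 1`, `abs_det_swapCLM`), and the band integrands `−Im g'`, `+Im g'`
cancel (Cauchy–Riemann; `KZ.of_add_of_mem_relations_of_eqOn_neg`).

Sources: Kontsevich–Zagier, *Periods* (2001), §1.2. Fully proved ([folklore]).
-/

noncomputable section

open MvPolynomial Set Metric MeasureTheory
open Literature.ModelTheory.ExponentialFields Literature.NumberTheory.Transcendental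
open Literature.NumberTheory.Transcendental.KZ

namespace Summit.KontsevichZagierPeriods.ComplexOrientations.CauchyMoveAux

/-- The complex number `x₀ + i x₁` attached to a point `x ∈ ℝ²` (local notation). -/
local notation:max "cx " x:max => (Complex.mk (x 0) (x 1))

/-- The complex number `x₁ + i x₀` attached to a point `x ∈ ℝ²` (swapped; local notation). -/
local notation:max "cxs " x:max => (Complex.mk (x 1) (x 0))

variable {ρ R' : ℝ} {g : ℂ → ℂ}

/-! ### Green's theorem for `Re (g dt)` on the disc, as a chain of KZ moves -/

/-- The coordinate swap of `ℝ²` as a continuous linear map. -/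
theorem swapCLM_apply (x : Fin 2 → ℝ) :
    (ContinuousLinearMap.pi fun i => ContinuousLinearMap.proj (R := ℝ) (φ := fun _ : Fin 2 => ℝ)
      (Equiv.swap (0 : Fin 2) 1 i)) x = ![x 1, x 0] := by
  ext i
  fin_cases i <;> simp [Equiv.swap_apply_left, Equiv.swap_apply_right]

/-- The coordinate swap has determinant of absolute value `1`. -/
theorem abs_det_swapCLM :
    |(ContinuousLinearMap.pi fun i => ContinuousLinearMap.proj (R := ℝ) (φ := fun _ : Fin 2 => ℝ)
      (Equiv.swap (0 : Fin 2) 1 i)).det| = 1 := by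
  set L := (ContinuousLinearMap.pi fun i => ContinuousLinearMap.proj (R := ℝ)
    (φ := fun _ : Fin 2 => ℝ) (Equiv.swap (0 : Fin 2) 1 i)) with hL
  have h : L.det = -1 := by
    show LinearMap.det (L : (Fin 2 → ℝ) →ₗ[ℝ] (Fin 2 → ℝ)) = -1
    rw [← LinearMap.det_toMatrix', Matrix.det_fin_two]
    simp [LinearMap.toMatrix'_apply, hL, Equiv.swap_apply_left, Equiv.swap_apply_right]
  rw [h]; norm_num

/-- **Green's theorem for `Re (g dt)` on the disc `x₀² + x₁² ≤ ρ²` inside the KZ calculus.**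
With `b(u) = √(ρ² − u²)` on `τ = [-ρ, ρ]`, the two boundary representations
`[τ, u ↦ Re g(u, b u) − Re g(u, −b u)]` and `[τ, v ↦ Im g(b v, v) − Im g(−b v, v)]` sum to a
relation: both are Newton–Leibniz moves (primitives `Re g` along `v`, resp. `Im g` along `u` in
swapped coordinates, rule (3)), the swapped band is moved back by the coordinate swap (rule (2)),
and the two band integrands `∓ Im g'` cancel by Cauchy–Riemann (rule (1b)). -/
theorem green (hρ : 0 < ρ) (halg : IsAlgebraic ℚ ρ) (hR : ρ < R')
    (hg : DifferentiableOn ℂ g (ball 0 R'))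
    (hPs : IsSemialgebraicFunOn ℚ {x : Fin 2 → ℝ | x 0 ^ 2 + x 1 ^ 2 ≤ ρ ^ 2}
      (fun x => (g (cx x)).re))
    (hQs : IsSemialgebraicFunOn ℚ {x : Fin 2 → ℝ | x 0 ^ 2 + x 1 ^ 2 ≤ ρ ^ 2}
      (fun x => (g (cx x)).im))
    (hHs : IsSemialgebraicFunOn ℚ {x : Fin 2 → ℝ | x 0 ^ 2 + x 1 ^ 2 ≤ ρ ^ 2}
      (fun x => (deriv g (cx x)).im)) :
    ∃ rd rd' : IntegralRep 1,
      rd.domain = {u : Fin 1 → ℝ | u 0 ^ 2 ≤ ρ ^ 2} ∧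
      (rd.integrand = fun u => (g ⟨u 0, √(ρ ^ 2 - u 0 ^ 2)⟩).re -
        (g ⟨u 0, -√(ρ ^ 2 - u 0 ^ 2)⟩).re) ∧
      rd'.domain = {u : Fin 1 → ℝ | u 0 ^ 2 ≤ ρ ^ 2} ∧
      (rd'.integrand = fun u => (g ⟨√(ρ ^ 2 - u 0 ^ 2), u 0⟩).im -
        (g ⟨-√(ρ ^ 2 - u 0 ^ 2), u 0⟩).im) ∧
      of rd + of rd' ∈ relations := by
  -- notation
  set τ : Set (Fin 1 → ℝ) := {u | u 0 ^ 2 ≤ ρ ^ 2} with hτ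
  set D : Set (Fin 2 → ℝ) := {x | x 0 ^ 2 + x 1 ^ 2 ≤ ρ ^ 2} with hD
  set bf : (Fin 1 → ℝ) → ℝ := fun u => √(ρ ^ 2 - u 0 ^ 2) with hbf
  set af : (Fin 1 → ℝ) → ℝ := fun u => -√(ρ ^ 2 - u 0 ^ 2) with haf
  have hτs : IsSemialgebraic ℚ τ := isSemialgebraic_tau halg
  have hDs : IsSemialgebraic ℚ D := isSemialgebraic_disc halg
  have hbs : IsSemialgebraicFunOn ℚ τ bf := isSemialgebraicFunOn_b halg
  have has : IsSemialgebraicFunOn ℚ τ af := isSemialgebraicFunOn_a halg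
  have hab : ∀ u ∈ τ, af u ≤ bf u := fun u _ => by
    simp only [haf, hbf]; linarith [Real.sqrt_nonneg (ρ ^ 2 - u 0 ^ 2)]
  have hband : KZlog.band τ af bf = D := band_eq_disc ρ
  have hDc : IsCompact D := isCompact_disc ρ
  have hτc : IsCompact τ := isCompact_tau ρ
  have hball : ∀ x ∈ D, cx x ∈ ball (0 : ℂ) R' := fun x hx => cx_mem_ball_of_mem_disc hρ hR hx
  have hballs : ∀ x ∈ D, cxs x ∈ ball (0 : ℂ) R' := fun x hx => cxs_mem_ball_of_mem_disc hρ hR hx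
  -- edge points are on the circle
  have hsq : ∀ u ∈ τ, bf u ^ 2 = ρ ^ 2 - u 0 ^ 2 := fun u hu =>
    Real.sq_sqrt (by simp only [hτ, mem_setOf_eq] at hu; linarith)
  have hedge_b : ∀ u ∈ τ, (Fin.snoc u (bf u) : Fin 2 → ℝ) ∈ D := fun u hu => by
    show u 0 ^ 2 + bf u ^ 2 ≤ ρ ^ 2
    rw [hsq u hu]; linarith
  have hedge_a : ∀ u ∈ τ, (Fin.snoc u (af u) : Fin 2 → ℝ) ∈ D := fun u hu => by
    show u 0 ^ 2 + (-bf u) ^ 2 ≤ ρ ^ 2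
    rw [neg_sq, hsq u hu]; linarith
  have hfib : ∀ u ∈ τ, ∀ t ∈ Icc (af u) (bf u), (Fin.snoc u t : Fin 2 → ℝ) ∈ D := by
    intro u hu t ht
    have := (KZlog.snoc_mem_band (τ := τ) (a := af) (b := bf)).2 ⟨hu, ht⟩
    rwa [hband] at this
  -- continuity
  have hgc : ContinuousOn (fun x : Fin 2 → ℝ => g (cx x)) D := continuousOn_g_cx hρ hR hg
  have hgcs : ContinuousOn (fun x : Fin 2 → ℝ => g (cxs x)) D := continuousOn_g_cxs hρ hR hg
  have hg'c : ContinuousOn (fun x : Fin 2 → ℝ => deriv g (cx x)) D :=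
    continuousOn_g_cx hρ hR ((hg.analyticOnNhd isOpen_ball).deriv.differentiableOn)
  have hg'cs : ContinuousOn (fun x : Fin 2 → ℝ => deriv g (cxs x)) D :=
    continuousOn_g_cxs hρ hR ((hg.analyticOnNhd isOpen_ball).deriv.differentiableOn)
  have hbc : Continuous bf := ((continuous_const.sub ((continuous_apply 0).pow 2)).sqrt)
  have hsnoc_b : Continuous fun u : Fin 1 → ℝ => (Fin.snoc u (bf u) : Fin 2 → ℝ) :=
    Continuous.finSnoc (A := fun _ : Fin 2 => ℝ) (f := fun u : Fin 1 → ℝ => u) continuous_id hbc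
  have hsnoc_a : Continuous fun u : Fin 1 → ℝ => (Fin.snoc u (af u) : Fin 2 → ℝ) :=
    Continuous.finSnoc (A := fun _ : Fin 2 => ℝ) (f := fun u : Fin 1 → ℝ => u) continuous_id hbc.neg
  have hsnoc_t : ∀ u : Fin 1 → ℝ, Continuous fun t : ℝ => (Fin.snoc u t : Fin 2 → ℝ) := fun u =>
    Continuous.finSnoc (A := fun _ : Fin 2 => ℝ) (f := fun _ : ℝ => u) continuous_const continuous_id
  -- the edge maps are semialgebraic
  have hmap_b : IsSemialgebraicMapOn ℚ τ fun u => (Fin.snoc u (bf u) : Fin 2 → ℝ) := by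
    refine IsSemialgebraicMapOn.of_forall hτs fun j => ?_
    fin_cases j
    · exact (isSemialgebraicFunOn_aeval hτs (X 0)).congr fun u _ => by simp
    · exact hbs
  have hmap_a : IsSemialgebraicMapOn ℚ τ fun u => (Fin.snoc u (af u) : Fin 2 → ℝ) := by
    refine IsSemialgebraicMapOn.of_forall hτs fun j => ?_
    fin_cases j
    · exact (isSemialgebraicFunOn_aeval hτs (X 0)).congr fun u _ => by simp
    · exact has
  ------------------------------------------------------------------
  -- A. Newton–Leibniz along `v` with primitive `Re g`
  ------------------------------------------------------------------
  obtain ⟨rbA, rdA, hrbAd, hrbAi, hrdAd, hrdAi, hA⟩ := exists_band_newtonLeibniz hτs af bf has hbs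
    hab (fun z => (g (cx z)).re) (fun z => -(deriv g (cx z)).im)
    (by rw [hband]; exact hPs) (by rw [hband]; exact hHs.neg)
    (fun u hu => (Complex.continuous_re.comp_continuousOn hgc).comp (hsnoc_t u).continuousOn
      fun t ht => hfib u hu t ht)
    (fun u hu t ht => hasDerivAt_re_vertical hg (u 0) t
      (hball _ (hfib u hu t (Ioo_subset_Icc_self ht))))
    (by rw [hband]
        exact ((Complex.continuous_im.comp_continuousOn hg'c).neg).integrableOn_compact hDc)
    (IsSemialgebraicFunOn.sub_holds
      (IsSemialgebraicFunOn.comp_isSemialgebraicMapOn_holds hPs hmap_b hedge_b)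
      (IsSemialgebraicFunOn.comp_isSemialgebraicMapOn_holds hPs hmap_a hedge_a))
    ((((Complex.continuous_re.comp_continuousOn hgc).comp hsnoc_b.continuousOn hedge_b).sub
      ((Complex.continuous_re.comp_continuousOn hgc).comp hsnoc_a.continuousOn hedge_a)
      ).integrableOn_compact hτc)
  ------------------------------------------------------------------
  -- B. Newton–Leibniz along `u` (swapped coordinates) with primitive `Im g`
  ------------------------------------------------------------------
  have hswap_maps : MapsTo (fun x : Fin 2 → ℝ => (![x 1, x 0] : Fin 2 → ℝ)) D D := fun x hx => by
    show x 1 ^ 2 + x 0 ^ 2 ≤ ρ ^ 2; simp only [hD, mem_setOf_eq] at hx; linarith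
  have hswap_sa : IsSemialgebraicMapOn ℚ D fun x : Fin 2 → ℝ => (![x 1, x 0] : Fin 2 → ℝ) :=
    (isSemialgebraicMapOn_aeval hDs ![X 1, X 0]).congr fun x _ => by
      ext i; fin_cases i <;> simp
  have hQs' : IsSemialgebraicFunOn ℚ D fun x => (g (cxs x)).im :=
    (IsSemialgebraicFunOn.comp_isSemialgebraicMapOn_holds hQs hswap_sa hswap_maps).congr
      fun x _ => by simp
  have hHs' : IsSemialgebraicFunOn ℚ D fun x => (deriv g (cxs x)).im :=
    (IsSemialgebraicFunOn.comp_isSemialgebraicMapOn_holds hHs hswap_sa hswap_maps).congr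
      fun x _ => by simp
  obtain ⟨rbB, rdB, hrbBd, hrbBi, hrdBd, hrdBi, hB⟩ := exists_band_newtonLeibniz hτs af bf has hbs
    hab (fun z => (g (cxs z)).im) (fun z => (deriv g (cxs z)).im)
    (by rw [hband]; exact hQs') (by rw [hband]; exact hHs')
    (fun u hu => (Complex.continuous_im.comp_continuousOn hgcs).comp (hsnoc_t u).continuousOn
      fun t ht => hfib u hu t ht)
    (fun u hu t ht => hasDerivAt_im_horizontal hg (u 0) t
      (hballs _ (hfib u hu t (Ioo_subset_Icc_self ht))))
    (by rw [hband]
        exact (Complex.continuous_im.comp_continuousOn hg'cs).integrableOn_compact hDc)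
    (IsSemialgebraicFunOn.sub_holds
      (IsSemialgebraicFunOn.comp_isSemialgebraicMapOn_holds hQs' hmap_b hedge_b)
      (IsSemialgebraicFunOn.comp_isSemialgebraicMapOn_holds hQs' hmap_a hedge_a))
    ((((Complex.continuous_im.comp_continuousOn hgcs).comp hsnoc_b.continuousOn hedge_b).sub
      ((Complex.continuous_im.comp_continuousOn hgcs).comp hsnoc_a.continuousOn hedge_a)
      ).integrableOn_compact hτc)
  ------------------------------------------------------------------
  -- C. the swap move and the Cauchy–Riemann cancellation
  ------------------------------------------------------------------
  let rbC : IntegralRep 2 := ⟨D, fun x => (deriv g (cx x)).im, hDs, hHs,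
    (Complex.continuous_im.comp_continuousOn hg'c).integrableOn_compact hDc⟩
  set L := (ContinuousLinearMap.pi fun i => ContinuousLinearMap.proj (R := ℝ)
    (φ := fun _ : Fin 2 => ℝ) (Equiv.swap (0 : Fin 2) 1 i)) with hL
  have hLx : ∀ x, L x = ![x 1, x 0] := swapCLM_apply
  have hC : of rbC - of rbB ∈ relations := by
    refine changeOfVariablesRel_subset_relations
      (of_sub_of_mem_changeOfVariablesRel_linear rbC rbB L ?_ ?_ ?_ ?_)
    · exact hswap_sa.congr fun x _ => (hLx x).symm
    · intro x _ y _ hxy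
      rw [hLx, hLx] at hxy
      have h0 := congr_fun hxy 0; have h1 := congr_fun hxy 1
      simp at h0 h1
      ext i; fin_cases i <;> assumption
    · rw [hrbBd, hband]
      ext y
      constructor
      · intro hy
        exact ⟨![y 1, y 0], hswap_maps hy, by rw [hLx]; ext i; fin_cases i <;> rfl⟩
      · rintro ⟨x, hx, rfl⟩
        rw [hLx]; exact hswap_maps hx
    · intro x _
      rw [abs_det_swapCLM, mul_one, hrbBi, hLx]
      rfl
  have hcancel : of rbC + of rbA ∈ relations :=
    of_add_of_mem_relations_of_eqOn_neg (by rw [hrbAd, hband]) fun x _ => by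
      rw [hrbAi]; rfl
  ------------------------------------------------------------------
  -- D. bookkeeping
  ------------------------------------------------------------------
  refine ⟨rdA, rdB, hrdAd, ?_, hrdBd, ?_, ?_⟩
  · rw [hrdAi]; rfl
  · rw [hrdBi]; rfl
  · have : of rdA + of rdB =
        -(of rbA - of rdA) - (of rbB - of rdB) - (of rbC - of rbB) + (of rbC + of rbA) := by abel
    rw [this]
    exact relations.add_mem (relations.sub_mem (relations.sub_mem (relations.neg_mem hA) hB) hC)
      hcancel

end Summit.KontsevichZagierPeriods.ComplexOrientations.CauchyMoveAux
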